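import Summits.BirchSwinnertonDyer.BirchSwinnertonDyer.Theorems.PrintCFramBottomClassIndexLawFiveLeBorelDescentAssembly
import HarnessLib

/-!
# Route `PrintCFram`, crux C2 `BottomClassIndexLawFiveLe` (stmt-BirchSwinnertonDyer-20372), line
# `eisenstein-resource-bdp-line`, stub `stub_kolyvaginUpper_borelCM_pairSum_offKrizLi`:
# **`p^{2M₀+1} · Ш(W/K)[p^M] = 0` AT THE BOREL CM-RAMIFIED PRIME FROM THE LEVEL-`p^M` LEAVES**, and the passage to
# the finiteness of `Ш(W/K)[p^∞]`
# (cell `bsd-print-cfram`, seat `bsd-line-cfram-p1-w2` g7; helper `--supports` 20372; 0 facts, 0 defs, 0 sorry)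

HONEST FRAMING. Nothing about BSD is proved here, and nothing of the stub itself. `…BorelDescentAssembly` gives
`p^{2M₀+1}·Sel ⊆ ℤx` on `H¹(K, W[p^M])` from the displayed leaves; here `Sel = Sel^{(p^M)}(W/K)` (`selmerGroup`) and
`x = δ_M x₀` dies in `H¹(K, W)` (`x ∈ ker torsionH1ToH1`), and the conclusion is moved to `Ш`:

* `pow_smul_sha_eq_zero_of_pow_zsmul_mem_zmultiples` — GENERIC (any elliptic curve over a number field, any `n ≠ 0`,
  any exponent `C`): if `p^C·Sel^{(n)}(E/K) ⊆ ℤx` with `x ∈ ker(H¹(K, E[n]) → H¹(K, E))`, then `p^C c = 0` for every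
  `c ∈ Ш(E/K)` with `n c = 0` (Silverman X.4.2(a): `c` lifts to `Sel^{(n)}`; tree `map_torsionH1ToH1_selmerGroup_holds`).
* **`pow_smul_sha_eq_zero_of_cmRamified`** — the Borel CM-ramified instance at level `p^M`: from the leaves of
  `…BorelDescentAssembly` with `Sel = selmerGroup` and `x ∈ ker`: **`p^{2M₀+1} c = 0` for every `c ∈ Ш(W/K)[p^M]`**.
* `finite_sha_primary_of_forall_level` — GENERIC bookkeeping: if for every `j ≥ 1` every class of `Ш` killed by `p^j`
  is killed by `p^C`, then `p^C·Ш[p^∞] = 0` and `Ш(E/K)[p^∞]` is finite (`finite_sha_primary_of_pow_smul_eq_zero`). So the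
  leaves at EVERY level `p^j` (`j ≥ 1`, common `M₀`) give the finiteness of `Ш(W/K″)[p^∞]` with exponent `2M₀+1` at the
  Borel CM-ramified prime — Kolyvagin's Thm. A there, one `p`-step weaker, NO image hypothesis.

THEOREMS ONLY; no definition, no named fact introduced, no `sorry`. BSD is not proved by any of this; no summit
statement is proved by this seat. References: [GrossLMS1991] Thm. 1.3 (2), §10; [McCallumLMS1991] §1; [SilvermanAEC2009] X.4.2.
-/

set_option autoImplicit false
-- `…BirchSwinnertonDyer.BirchSwinnertonDyer.Theorems…` is the problem's mandated namespace (D-0017).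
set_option linter.dupNamespace false

noncomputable section

open scoped Classical

universe u

namespace Summit.BirchSwinnertonDyer.BirchSwinnertonDyer.Theorems.PrintCFram.BorelKolyvaginPairing

open WeierstrassCurve NumberField IsDedekindDomain Field Literature.NumberTheory.EllipticCurves
  Literature.NumberTheory.GaloisRepresentations Literature.NumberTheory.EllipticCurves.Rank1Residual
  Literature.NumberTheory.EllipticCurves.KolyvaginDescent
  Summit.BirchSwinnertonDyer.BirchSwinnertonDyer.Theorems.PrintCFram.BorelHomothety
  Summit.BirchSwinnertonDyer.BirchSwinnertonDyer.Theorems.PrintCFram.BorelDescent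

/-! ## §1 Generic: annihilation of `Sel^{(n)}` modulo `ℤx` kills `Ш[n]` -/

section Generic

variable {F : Type u} [Field F] [NumberField F] (E : WeierstrassCurve F)

/-- **`p^C·Sel^{(n)}(E/K) ⊆ ℤx` with `x` dying in `H¹(K, E)` gives `p^C·Ш(E/K)[n] = 0`.**
[cite: SilvermanAEC2009, Thm X.4.2(a)] [cite: GrossLMS1991, §1 Thm. 1.3 (2)] -/
theorem pow_smul_sha_eq_zero_of_pow_zsmul_mem_zmultiples [E.IsElliptic] {p : ℕ} {n : ℕ} (hn : n ≠ 0)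
    (C : ℕ) (x : galH1Torsion E ((n : ℕ) : ℤ)) (hx : x ∈ (torsionH1ToH1 E ((n : ℕ) : ℤ)).ker)
    (hann : ∀ s ∈ selmerGroup E ((n : ℕ) : ℤ), ((p : ℤ) ^ C) • s ∈ AddSubgroup.zmultiples x)
    (c : E.sha) (hc : n • c = 0) : p ^ C • c = 0 := by
  have hn' : ((n : ℕ) : ℤ) ≠ 0 := by exact_mod_cast hn
  have hc' : (c : E.galH1) ∈ E.sha ⊓ AddSubgroup.torsionBy E.galH1 ((n : ℕ) : ℤ) := by
    refine AddSubgroup.mem_inf.mpr ⟨c.2, ?_⟩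
    rw [mem_torsionBy_iff, natCast_zsmul, ← AddSubgroupClass.coe_nsmul, hc, ZeroMemClass.coe_zero]
  rw [← E.map_torsionH1ToH1_selmerGroup_holds hn', AddSubgroup.mem_map] at hc'
  obtain ⟨s, hs, hts⟩ := hc'
  have hker : AddSubgroup.zmultiples x ≤ (torsionH1ToH1 E ((n : ℕ) : ℤ)).ker :=
    AddSubgroup.zmultiples_le_of_mem hx
  have h0 : torsionH1ToH1 E ((n : ℕ) : ℤ) (((p : ℤ) ^ C) • s) = 0 :=
    (AddMonoidHom.mem_ker).mp (hker (hann s hs))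
  rw [map_zsmul, hts] at h0
  apply Subtype.ext
  rw [AddSubgroupClass.coe_nsmul, ZeroMemClass.coe_zero, ← natCast_zsmul, Nat.cast_pow]
  exact h0

/-- **From every level to `Ш[p^∞]`**: if for every `j ≥ 1` every class of `Ш(E/K)` killed by `p^j` is killed by
`p^C`, then `Ш(E/K)[p^∞]` is finite (and killed by `p^C`). [cite: SilvermanAEC2009, Thm X.4.2(b)] -/
theorem finite_sha_primary_of_forall_level [E.IsElliptic] {p : ℕ} (hp : p.Prime) (C : ℕ)
    (h : ∀ j : ℕ, 1 ≤ j → ∀ c : E.sha, p ^ j • c = 0 → p ^ C • c = 0) :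
    Set.Finite {c : E.sha | ∃ j : ℕ, p ^ j • c = 0} := by
  refine E.finite_sha_primary_of_pow_smul_eq_zero hp.ne_zero (M := C) fun c ⟨j, hj⟩ ↦ ?_
  rcases Nat.eq_zero_or_pos j with h0 | hpos
  · subst h0
    rw [pow_zero, one_smul] at hj
    rw [hj, smul_zero]
  · exact h j hpos c hj

end Generic

/-! ## §2 The Borel CM-ramified instance at level `p^M` -/

section Borel

variable (W : WeierstrassCurve ℚ) [W.IsElliptic] (p : ℕ) [hp : Fact p.Prime]
variable {K : Type} [Field K] [NumberField K] {Pl : Type*}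

/-- **`p^{2M₀+1} · Ш(W/K)[p^M] = 0` at the Borel CM-ramified prime, from the level-`p^M` leaves.** The hypotheses
are those of `pow_zsmul_mem_zmultiples_of_cmRamified` (`…BorelDescentAssembly`) with `Sel = Sel^{(p^M)}(W/K)` and,
in addition, `x ∈ ker(H¹(K, W[p^M]) → H¹(K, W))` (e.g. `x = δ_M x₀`). [cite: GrossLMS1991, §1 Thm. 1.3 (2), §10]
[cite: McCallumLMS1991, §1 Theorem (Kolyvagin)] -/
theorem pow_smul_sha_eq_zero_of_cmRamified
    (hC : Literature.NumberTheory.Automorphic.chebotarev_artinRep) {N : ℕ} [NeZero N]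
    (hCM : W.HasCM) (h5 : 5 ≤ p) (hram : CMRamified W p)
    {s₀ : AlgebraicClosure ℚ} {μ : AddMonoid.End W.geomPoints} {m : ℤ}
    (hs₀ : s₀ ^ 2 = ((-(p : ℤ) : ℤ) : AlgebraicClosure ℚ)) (hm : m.natAbs = p)
    (hμμ : ∀ P, μ (μ P) = m • P)
    (hcomm : ∀ g : absoluteGaloisGroup ℚ, g • s₀ = s₀ → ∀ P, μ (g • P) = g • μ P)
    (hanti : ∀ g : absoluteGaloisGroup ℚ, g • s₀ = -s₀ → ∀ P, μ (g • P) = -(g • μ P))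
    (hK : IsImaginaryQuadratic K) (hKp : ∀ y : K, y ^ 2 ≠ -(p : K)) {M : ℕ} (hM : 1 ≤ M)
    {cK : K ≃ₐ[ℚ] K} {c₀ : absoluteGaloisGroup ℚ} (hc₀ : IsComplexConjugation (Rat.castHom ℝ) c₀)
    (ht : IsLiftOfAut cK (absGaloisTransport (K := ℚ) (L := K) c₀).toRingEquiv) (hcc : cK * cK = 1)
    {ε : ℤ} (hε : ε = 1 ∨ ε = -1) (hη : ∀ P : W.geomPoints, μ P = 0 → c₀ • P = ε • P)
    -- the displayed non-Čebotarev data on `V = H¹(K, W[p^M])`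
    (Loc : Pl → AddSubgroup (galH1Torsion (W.baseChange K) ((p ^ M : ℕ) : ℤ)))
    (pl : ℕ → Pl) (Dv : Pl → ℕ → Prop)
    (hτSel : ∀ s ∈ selmerGroup (W.baseChange K) ((p ^ M : ℕ) : ℤ),
      conjAct W cK ((p ^ M : ℕ) : ℤ) s ∈ selmerGroup (W.baseChange K) ((p ^ M : ℕ) : ℤ))
    (hSel : ∀ s, s ∈ selmerGroup (W.baseChange K) ((p ^ M : ℕ) : ℤ) ↔ ∀ v, s ∈ Loc v)
    (hdv : ∀ ℓ, (IsKolyvaginPrime N W K p ℓ ∧ FrobEqFrobInfty W K (p ^ M) ℓ) → ∀ v, Dv v ℓ ↔ v = pl ℓ)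
    (hdvm : ∀ ℓ ℓ', (IsKolyvaginPrime N W K p ℓ ∧ FrobEqFrobInfty W K (p ^ M) ℓ) →
      (IsKolyvaginPrime N W K p ℓ' ∧ FrobEqFrobInfty W K (p ^ M) ℓ') → ∀ v, Dv v (ℓ * ℓ') → Dv v ℓ ∨ Dv v ℓ')
    {xc : galH1Torsion (W.baseChange K) ((p ^ M : ℕ) : ℤ)}
    (hxSel : xc ∈ selmerGroup (W.baseChange K) ((p ^ M : ℕ) : ℤ))
    (hxord : ((p : ℤ) ^ (M - 1)) • xc ≠ 0) (hτx : conjAct W cK ((p ^ M : ℕ) : ℤ) xc = ε • xc) {M₀ : ℕ}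
    (cl : ℕ → galH1Torsion (W.baseChange K) ((p ^ M : ℕ) : ℤ)) (hc1 : cl 1 = ((p : ℤ) ^ M₀) • xc)
    (hτc : ∀ n, KolSupp (fun ℓ ↦ IsKolyvaginPrime N W K p ℓ ∧ FrobEqFrobInfty W K (p ^ M) ℓ) n →
      conjAct W cK ((p ^ M : ℕ) : ℤ) (cl n) = (ε * (-1) ^ n.primeFactors.card) • cl n)
    (hcloc : ∀ n, KolSupp (fun ℓ ↦ IsKolyvaginPrime N W K p ℓ ∧ FrobEqFrobInfty W K (p ^ M) ℓ) n →
      ∀ v, ¬ Dv v n → cl n ∈ Loc v)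
    (hc44 : ∀ ℓ n, (IsKolyvaginPrime N W K p ℓ ∧ FrobEqFrobInfty W K (p ^ M) ℓ) →
      KolSupp (fun ℓ ↦ IsKolyvaginPrime N W K p ℓ ∧ FrobEqFrobInfty W K (p ^ M) ℓ) (ℓ * n) → ∀ a : ℕ,
      (((p : ℤ) ^ a) • cl (ℓ * n) ∈ Loc (pl ℓ)) ↔
        ((p : ℤ) ^ a) • cl n ∈ ⨅ (v : HeightOneSpectrum (𝓞 K)) (_ : (ℓ : 𝓞 K) ∈ v.asIdeal),
          (W.baseChange K).torsionLocalKer (v.adicCompletion K) ((p ^ M : ℕ) : ℤ))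
    (hdual : ∀ ℓ, (IsKolyvaginPrime N W K p ℓ ∧ FrobEqFrobInfty W K (p ^ M) ℓ) → ∀ ν : ℤ,
      (ν = 1 ∨ ν = -1) → ∀ d, conjAct W cK ((p ^ M : ℕ) : ℤ) d = ν • d → (∀ v, v ≠ pl ℓ → d ∈ Loc v) →
      ∀ s ∈ selmerGroup (W.baseChange K) ((p ^ M : ℕ) : ℤ), conjAct W cK ((p ^ M : ℕ) : ℤ) s = ν • s →
      ∀ a, a < M →
      ((p : ℤ) ^ a) • d ∉ Loc (pl ℓ) →
        ((p : ℤ) ^ (M - 1 - a)) • s ∈ ⨅ (v : HeightOneSpectrum (𝓞 K)) (_ : (ℓ : 𝓞 K) ∈ v.asIdeal),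
          (W.baseChange K).torsionLocalKer (v.adicCompletion K) ((p ^ M : ℕ) : ℤ))
    (hxker : xc ∈ (torsionH1ToH1 (W.baseChange K) ((p ^ M : ℕ) : ℤ)).ker)
    (c : (W.baseChange K).sha) (hc : p ^ M • c = 0) : p ^ (2 * M₀ + 1) • c = 0 := by
  haveI : (W.baseChange K).IsElliptic := inferInstanceAs (W.map (algebraMap ℚ K)).IsElliptic
  exact pow_smul_sha_eq_zero_of_pow_zsmul_mem_zmultiples (W.baseChange K) (pow_ne_zero M hp.out.ne_zero)
    (2 * M₀ + 1) xc hxker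
    (fun s hs ↦ pow_zsmul_mem_zmultiples_of_cmRamified W p hC (N := N) hCM h5 hram hs₀ hm hμμ hcomm hanti hK hKp hM
      hc₀ ht hcc hε hη (selmerGroup (W.baseChange K) ((p ^ M : ℕ) : ℤ)) Loc pl Dv hτSel hSel hdv hdvm hxSel hxord hτx
      cl hc1 hτc hcloc hc44 hdual hs) c hc

end Borel

end Summit.BirchSwinnertonDyer.BirchSwinnertonDyer.Theorems.PrintCFram.BorelKolyvaginPairing

end
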